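import Literature.MathematicalPhysics.QuantumManyBody.BoseGasThermodynamicLimitRuelle
import Literature.MathematicalPhysics.QuantumManyBody.BoseGasProductState
import Literature.MathematicalPhysics.QuantumManyBody.SwapPurity
import Literature.MathematicalPhysics.QuantumManyBody.BoseGasClusterStates
import Literature.MathematicalPhysics.QuantumManyBody.JelliumBoseGasCondensateDilation
import Literature.MathematicalPhysics.QuantumManyBody.BoseGasDirichletWall
import HarnessLib

/-!
# Cat states: fragmented states at low kinetic energy (mode-free energy windows are gap-limited)

Topic `Literature/MathematicalPhysics/QuantumManyBody` (negative knowledge filed by the crux disprover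
of `PeriodicToDirichlet`, stmt-AtomisticToContinuum-9483 — "periodic ground-state BEC ⇒ Dirichlet
ground-state BEC" — gen 2). Over the vocabulary of `BoseEinsteinCondensation.lean` /
`PeriodicBoseGas.lean` (`TrialState`, `energy`, `maxOccupation`, `condensateOccupation`) we
construct, for the FREE gas in any box, explicit many-body states whose kinetic energy is a
bounded number of gaps per particle above the ground state but whose one-particle density matrix
has NO macroscopic eigenvalue:

* `powFun u N = u^{⊗N}`, `powState N = β^{⊗N}` (all particles in one fixed `C¹` bump `β` of the
  unit cube, `unitBump`; free energy `N · 𝓔₀[β]`, `energy_powState`);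
* `blockState N m j` — `β^{⊗N}` translated into one of the `m³` unit sub-cubes (`blockSet m j`,
  corners `2j + ½`, unit gaps) of the box of side `2m`;
* `catFun N m = (m³)^{-1/2} ∑_j β_j^{⊗N}`, `catState` — the **cat state**: all `N` particles
  together in block `j`, superposed over the blocks. Since at most one block term is (differentially)
  active at any configuration, `𝓔₀[Ψ_cat] = N 𝓔₀[β]` (`energy_catState`) and
  `⟨φ, γ_{Ψ_cat} φ⟩ = (N/m³) ∑_j |⟨φ, β_j⟩|² ≤ N/m³` for every normalised mode
  (`occupation_catFun_le`, Cauchy–Schwarz block by block), i.e. `λ_max(γ_{Ψ_cat}) ≤ N/m³`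
  (`maxOccupation_catFun_le`);
* `exists_fragmented_trialState` — rescaled to any box `Λ_L` (`TrialState.dilate`): for all
  `m ≥ 1`, `N ≥ 2`, `L > 0` a Dirichlet trial state with `energy ≤ C_cat m² N/L²` and
  `λ_max ≤ N/m³` (`C_cat = 4𝓔₀[β]`, a universal constant); `exists_fragmented_periodicTrialState` —
  its periodisation on the torus of side `L`, with `n₀ ≤ λ_max ≤ N/m³`
  (`condensateOccupation_toPeriodic_le_maxOccupation`);
* `dirichlet_window_fraction_le`, `periodic_window_fraction_le`,
  `periodic_modeFree_window_fraction_le` — **energy-window condensation criteria are gap-limited,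
  cubically and mode-free**: a criterion "energy `≤ E₀ + w` ⇒ (`λ_max` or `n₀`) `≥ cN`" whose window
  `w` contains `C_cat m²` kinetic gaps `N/L²` certifies at most `c ≤ 1/m³`, in the Dirichlet box as
  on the torus.

Why it is recorded. The Galilei-boost witnesses of `Literature.Barriers.AtomisticToContinuum.
KineticGapLengthScalesNarrow` bound only the CONSTANT-MODE occupation `n₀` (a boosted condensate
is still a condensate: `λ_max = N`), only on the torus, and only linearly (`n₀ ≤ N/(M+1)` at `M²`
gaps); its scope caveats (b) [(2M+1)³-mode version] and (c) [non-periodic boundary conditions] were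
untyped. Cat states type both, for the mode-free `λ_max` of the conjunct `BoseEinsteinCondensation`
itself: on the DIRICHLET side, too, no energy-window argument wider than `O(N/L²)` can certify
`λ_max ≥ cN` — while the only bridge from the periodic hypothesis of stmt-0827/9483 to Dirichlet
states (periodisation) is separated from it by the Dirichlet wall (`BoseGasDirichletWall`), of
exactly that order for the free gas and far wider for the interacting gas. Data definitions
(`powFun`, `unitBump`, `catFun`, …) and theorems; `[folklore]` throughout (Schrödinger-cat /
NOON superpositions of spatially separated condensates are textbook examples of fragmentation).

## References

* [LSSY2005] E. H. Lieb, R. Seiringer, J. P. Solovej, J. Yngvason, *The Mathematics of the Bose Gas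
  and its Condensation* (2005), §1.2 (1.17)–(1.19) (`λ_max` of the one-particle density matrix).
* [MuellerEtAl2006] E. J. Mueller, T.-L. Ho, M. Ueda, G. Baym, *Fragmentation of
  Bose–Einstein condensates*, Phys. Rev. A 74 (2006) 033612 — cat-state fragmentation (§II.C).
-/

noncomputable section

namespace Literature.MathematicalPhysics.QuantumManyBody.BoseGas

open _root_.MeasureTheory _root_.Filter _root_.Topology
open scoped ENNReal NNReal ComplexConjugate

variable {N n : ℕ}

/-! ### The `N`-fold power of a one-body mode -/

/-- `u^{⊗N}(X) = ∏ᵢ u(xᵢ)`. [folklore] -/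
def powFun (u : Space → ℂ) (N : ℕ) (X : Config N) : ℂ := ∏ i, u (X i)

/-- The one-body function as a function of one-particle configurations. [folklore] -/
def oneFun (u : Space → ℂ) (Y : Config 1) : ℂ := u (Y 0)

/-- `u^{⊗0} = 1`. [folklore] -/
theorem powFun_zero (u : Space → ℂ) (X : Config 0) : powFun u 0 X = 1 := by
  simp [powFun]

/-- Recursion: `u^{⊗(n+1)} = u^{⊗n} ⊗ u` (blocks: first `n` particles, last particle). [folklore] -/
theorem powFun_succ (u : Space → ℂ) (n : ℕ) :
    powFun u (n + 1) = prodFun (powFun u n) (oneFun u) := by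
  funext X
  rw [powFun, Fin.prod_univ_castSucc]
  rfl

/-- Recursion at the FIRST particle: `u^{⊗(n+1)}(x, Y) = u(x) u^{⊗n}(Y)`. [folklore] -/
theorem powFun_vecCons (u : Space → ℂ) (n : ℕ) (x : Space) (Y : Config n) :
    powFun u (n + 1) (Matrix.vecCons x Y) = u x * powFun u n Y := by
  rw [powFun, Fin.prod_univ_succ]
  simp [powFun]

/-- The power is Bose-symmetric. [folklore] -/
theorem powFun_comp_perm (u : Space → ℂ) (σ : Equiv.Perm (Fin N)) (X : Config N) :
    powFun u N (X ∘ σ) = powFun u N X := by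
  unfold powFun
  exact Equiv.prod_comp σ (fun i => u (X i))

/-- The power vanishes as soon as one factor does. [folklore] -/
theorem powFun_eq_zero_of_exists (u : Space → ℂ) {X : Config N} (h : ∃ i, u (X i) = 0) :
    powFun u N X = 0 := by
  obtain ⟨i, hi⟩ := h
  exact Finset.prod_eq_zero (Finset.mem_univ i) hi

/-- The power of a `C¹` mode is `C¹`. [folklore] -/
theorem contDiff_powFun {u : Space → ℂ} (hu : ContDiff ℝ 1 (oneFun u)) :
    ∀ N, ContDiff ℝ 1 (powFun u N)
  | 0 => by
      have : powFun u 0 = fun _ => 1 := funext (powFun_zero u)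
      rw [this]; exact contDiff_const
  | n + 1 => by
      rw [powFun_succ]
      exact contDiff_prodFun (contDiff_powFun hu n) hu

/-- `‖u^{⊗N}‖² = (‖u‖²)^N`; here with `‖u‖² = 1`. [folklore] -/
theorem lintegral_powFun_sq {u : Space → ℂ} (hu : ContDiff ℝ 1 (oneFun u))
    (h1 : ∫⁻ Y, (‖oneFun u Y‖₊ : ℝ≥0∞) ^ 2 = 1) :
    ∀ N, ∫⁻ X, (‖powFun u N X‖₊ : ℝ≥0∞) ^ 2 = 1
  | 0 => by
      simp only [powFun_zero, nnnorm_one, ENNReal.coe_one, one_pow, lintegral_const, one_mul]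
      simp [volume_pi]
  | n + 1 => by
      rw [powFun_succ, lintegral_ennnorm_prodFun_sq (contDiff_powFun hu n).continuous hu.continuous,
        lintegral_powFun_sq hu h1 n, h1, one_mul]


/-- The free interaction vanishes. [folklore] -/
@[simp] theorem interaction_zeroPotential (X : Config N) : interaction (0 : ℝ → ℝ≥0∞) X = 0 := by
  simp [interaction]

/-- Free kinetic energy of the power: `T[u^{⊗N}] = N · T[u]` (with `‖u‖ = 1`). [folklore] -/
theorem rawEnergy_zero_powFun {u : Space → ℂ} (hu : ContDiff ℝ 1 (oneFun u))
    (h1 : ∫⁻ Y, (‖oneFun u Y‖₊ : ℝ≥0∞) ^ 2 = 1) :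
    ∀ N, rawEnergy 0 (powFun u N) = N * rawEnergy 0 (oneFun u)
  | 0 => by
      simp [rawEnergy, kineticDensity]
  | n + 1 => by
      have ih := rawEnergy_zero_powFun hu h1 n
      unfold rawEnergy at ih ⊢
      rw [powFun_succ, lintegral_energyDensity_prodFun (v := (0 : ℝ → ℝ≥0∞)) (contDiff_powFun hu n) hu
        measurable_const (fun _ _ _ _ => rfl), ih, h1, lintegral_powFun_sq hu h1 n]
      push_cast
      ring

/-! ### The unit bump and the power state -/

/-- A one-particle Dirichlet state of the unit box with finite (free) energy exists. [folklore] -/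
theorem exists_unitBump : ∃ β : TrialState 1 1, energy 0 β < ⊤ :=
  iInf_lt_iff.mp (groundStateEnergy_one_lt_top (0 : ℝ → ℝ≥0∞) one_pos)

/-- A fixed one-particle Dirichlet state of the unit box with finite kinetic energy. [folklore] -/
def unitBump : TrialState 1 1 := exists_unitBump.choose

/-- The unit bump has finite free energy. [folklore] -/
theorem energy_unitBump_lt_top : energy 0 unitBump < ⊤ := exists_unitBump.choose_spec

/-- Its one-body mode `b(x) = β(x)`. [folklore] -/
def bumpMode (x : Space) : ℂ := unitBump.ψ fun _ => x

/-- A one-particle configuration is determined by its only coordinate. [folklore] -/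
theorem const_apply_zero_eq (Y : Config 1) : (fun _ : Fin 1 => Y 0) = Y :=
  funext fun i => by rw [Subsingleton.elim i 0]

/-- The bump mode as a one-particle wave function is the unit bump. [folklore] -/
theorem oneFun_bumpMode : oneFun bumpMode = unitBump.ψ :=
  funext fun Y => congrArg unitBump.ψ (const_apply_zero_eq Y)

/-- The bump mode is `C¹`. [folklore] -/
theorem contDiff_oneFun_bumpMode : ContDiff ℝ 1 (oneFun bumpMode) := by
  rw [oneFun_bumpMode]; exact unitBump.contDiff

/-- The bump mode is normalised (one-particle configurations). [folklore] -/
theorem lintegral_oneFun_bumpMode_sq : ∫⁻ Y, (‖oneFun bumpMode Y‖₊ : ℝ≥0∞) ^ 2 = 1 := by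
  rw [oneFun_bumpMode]; exact unitBump.norm_eq

/-- The bump mode is normalised. [folklore] -/
theorem lintegral_bumpMode_sq : ∫⁻ x, (‖bumpMode x‖₊ : ℝ≥0∞) ^ 2 = 1 := by
  rw [← lintegral_funUnique_comp (fun x => (‖bumpMode x‖₊ : ℝ≥0∞) ^ 2)]
  exact lintegral_oneFun_bumpMode_sq

/-- The bump mode vanishes off the open unit cube. [folklore] -/
theorem bumpMode_eq_zero {x : Space} (hx : x ∉ box 1) : bumpMode x = 0 :=
  unitBump.eq_zero _ (by simpa [boxN] using hx)

/-- The bump mode is continuous. [folklore] -/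
theorem continuous_bumpMode : Continuous bumpMode :=
  unitBump.contDiff.continuous.comp (continuous_pi fun _ => continuous_id)

/-- **The power state** `β^{⊗N}`: all `N` particles in the unit bump — a Dirichlet trial state of
the unit box. [folklore] -/
def powState (N : ℕ) : TrialState N 1 where
  ψ := powFun bumpMode N
  contDiff := contDiff_powFun contDiff_oneFun_bumpMode N
  eq_zero X hX := by
    have : ∃ i, X i ∉ box 1 := by simpa [boxN] using hX
    obtain ⟨i, hi⟩ := this
    exact powFun_eq_zero_of_exists _ ⟨i, bumpMode_eq_zero hi⟩
  symm σ X := powFun_comp_perm _ σ X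
  norm_eq := lintegral_powFun_sq contDiff_oneFun_bumpMode lintegral_oneFun_bumpMode_sq N

/-- The wave function of the power state. [folklore] -/
@[simp] theorem powState_ψ (N : ℕ) : (powState N).ψ = powFun bumpMode N := rfl

/-- `𝓔₀[β^{⊗N}] = N · 𝓔₀[β]` (free gas). [folklore] -/
theorem energy_powState (N : ℕ) : energy 0 (powState N) = N * energy 0 unitBump := by
  rw [energy_eq_rawEnergy, energy_eq_rawEnergy, powState_ψ,
    rawEnergy_zero_powFun contDiff_oneFun_bumpMode lintegral_oneFun_bumpMode_sq N, oneFun_bumpMode]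


/-! ### Sums with at most one non-zero term -/

/-- Indicators of pairwise disjoint sets sum to at most the function. [folklore] -/
theorem sum_indicator_le_of_pairwise {ι α : Type*} [Fintype ι] (S : ι → Set α)
    (h : ∀ i j, i ≠ j → ∀ x, x ∈ S i → x ∉ S j) (g : α → ℝ≥0∞) (x : α) :
    ∑ i, (S i).indicator g x ≤ g x := by
  classical
  by_cases hex : ∃ i, x ∈ S i
  · obtain ⟨i₀, hi₀⟩ := hex
    rw [Finset.sum_eq_single i₀ (fun j _ hj => Set.indicator_of_notMem (h i₀ j hj.symm x hi₀) g)
      (fun h => absurd (Finset.mem_univ _) h), Set.indicator_of_mem hi₀]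
  · push Not at hex
    simp [Set.indicator_of_notMem (hex _)]

/-! ### Block geometry: `m³` unit cubes with unit gaps inside the box of side `2m` -/

/-- Index of a block. [folklore] -/
abbrev Block (m : ℕ) : Type := Fin 3 → Fin m

variable (m : ℕ)

/-- The corner `(2j + ½)` of block `j`. [folklore] -/
def corner (j : Block m) : Space := WithLp.toLp 2 fun k => 2 * ((j k : ℕ) : ℝ) + 1 / 2

/-- Coordinates of the corner. [folklore] -/
@[simp] theorem corner_apply (j : Block m) (k : Fin 3) :
    corner m j k = 2 * ((j k : ℕ) : ℝ) + 1 / 2 := rfl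

/-- The open unit cube of block `j`: `corner j + (0,1)³`. [folklore] -/
def blockSet (j : Block m) : Set Space := {x | x - corner m j ∈ box 1}

/-- Membership in a block, in coordinates. [folklore] -/
theorem mem_blockSet {j : Block m} {x : Space} :
    x ∈ blockSet m j ↔ ∀ k, 2 * ((j k : ℕ) : ℝ) + 1 / 2 < x k ∧ x k < 2 * ((j k : ℕ) : ℝ) + 3 / 2 := by
  simp only [blockSet, box, Set.mem_setOf_eq, Set.mem_Ioo, PiLp.sub_apply, corner_apply]
  refine forall_congr' fun k => ?_
  constructor <;> rintro ⟨h1, h2⟩ <;> constructor <;> linarith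

/-- Blocks are measurable. [folklore] -/
theorem measurableSet_blockSet (j : Block m) : MeasurableSet (blockSet m j) := by
  have : blockSet m j = ⋂ k : Fin 3,
      (fun x : Space => x k) ⁻¹' Set.Ioo (2 * ((j k : ℕ) : ℝ) + 1 / 2) (2 * ((j k : ℕ) : ℝ) + 3 / 2) := by
    ext x; simp [mem_blockSet]
  rw [this]
  exact MeasurableSet.iInter fun k => measurableSet_Ioo.preimage (by fun_prop)

/-- Distinct blocks are disjoint. [folklore] -/
theorem not_mem_blockSet_of_ne {j l : Block m} (hjl : j ≠ l) {x : Space} (hj : x ∈ blockSet m j) :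
    x ∉ blockSet m l := by
  intro hl
  rw [mem_blockSet] at hj hl
  obtain ⟨k, hk⟩ : ∃ k, j k ≠ l k := by
    by_contra h
    push Not at h
    exact hjl (funext h)
  have hk' : (j k : ℕ) ≠ (l k : ℕ) := fun h => hk (Fin.ext h)
  obtain ⟨h1, h2⟩ := hj k
  obtain ⟨h3, h4⟩ := hl k
  rcases lt_or_gt_of_ne hk' with hlt | hlt
  · have : ((j k : ℕ) : ℝ) + 1 ≤ ((l k : ℕ) : ℝ) := by exact_mod_cast hlt
    linarith
  · have : ((l k : ℕ) : ℝ) + 1 ≤ ((j k : ℕ) : ℝ) := by exact_mod_cast hlt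
    linarith

/-- Every block lies in the box of side `2m`. [folklore] -/
theorem blockSet_subset_box {j : Block m} {x : Space} (hx : x ∈ blockSet m j) : x ∈ box (2 * m) := by
  rw [mem_blockSet] at hx
  intro k
  obtain ⟨h1, h2⟩ := hx k
  have hjk : ((j k : ℕ) : ℝ) + 1 ≤ (m : ℝ) := by exact_mod_cast (j k).isLt
  have h0 : (0 : ℝ) ≤ ((j k : ℕ) : ℝ) := Nat.cast_nonneg _
  constructor
  · linarith
  · push_cast
    linarith

/-! ### Block states: the power state translated into block `j` -/

variable (N)

/-- The power state `β^{⊗N}` translated into block `j`. [folklore] -/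
def blockState (j : Block m) : SupportedState N (blockSet m j) :=
  (powState N).toSupported.translate (corner m j)

/-- The wave function of a block state. [folklore] -/
theorem blockState_ψ (j : Block m) (X : Config N) :
    (blockState N m j).ψ X = powFun bumpMode N (X - fun _ => corner m j) := rfl

variable {N m}

/-- Where a block state does not vanish, every particle is in its block. [folklore] -/
theorem mem_blockSet_of_blockState_ne_zero {j : Block m} {X : Config N}
    (h : (blockState N m j).ψ X ≠ 0) (i : Fin N) : X i ∈ blockSet m j := by
  by_contra hi
  exact h ((blockState N m j).eq_zero X ⟨i, hi⟩)

/-- At most one block state is non-zero at any configuration (`N ≥ 1`). [folklore] -/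
theorem blockState_pairwise_zero (hN : 0 < N) (X : Config N) {j l : Block m} (hjl : j ≠ l) :
    (blockState N m j).ψ X = 0 ∨ (blockState N m l).ψ X = 0 := by
  by_contra h
  push Not at h
  exact not_mem_blockSet_of_ne m hjl (mem_blockSet_of_blockState_ne_zero h.1 ⟨0, hN⟩)
    (mem_blockSet_of_blockState_ne_zero h.2 ⟨0, hN⟩)

/-- At most one block state has a non-zero derivative at any configuration (`N ≥ 1`). [folklore] -/
theorem fderiv_blockState_pairwise_zero (hN : 0 < N) (X : Config N) {j l : Block m} (hjl : j ≠ l) :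
    fderiv ℝ (blockState N m j).ψ X = 0 ∨ fderiv ℝ (blockState N m l).ψ X = 0 := by
  by_cases h : ∃ i, X i ∉ blockSet m j
  · exact Or.inl ((blockState N m j).fderiv_eq_zero X h)
  · push Not at h
    exact Or.inr ((blockState N m l).fderiv_eq_zero X
      ⟨⟨0, hN⟩, not_mem_blockSet_of_ne m hjl (h ⟨0, hN⟩)⟩)

/-- The block states have unit norm. [folklore] -/
theorem lintegral_blockState_sq (j : Block m) :
    ∫⁻ X, (‖(blockState N m j).ψ X‖₊ : ℝ≥0∞) ^ 2 = 1 :=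
  (blockState N m j).norm_eq

/-- … and the free energy of the power state. [folklore] -/
theorem rawEnergy_zero_blockState (j : Block m) :
    rawEnergy 0 (blockState N m j).ψ = N * energy 0 unitBump := by
  rw [blockState, rawEnergy_translate, ← energy_powState]
  rfl

/-- At most one block state is differentially active at any configuration, so the kinetic
density of the sum is the sum of the kinetic densities. [folklore] -/
theorem kineticDensity_sum_blockState (hN : 0 < N) (X : Config N) :
    kineticDensity (fun X => ∑ j, (blockState N m j).ψ X) X =
      ∑ j, kineticDensity (blockState N m j).ψ X := by
  have hd : ∀ j ∈ (Finset.univ : Finset (Block m)), DifferentiableAt ℝ (blockState N m j).ψ X :=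
    fun j _ => ((blockState N m j).contDiff.differentiable one_ne_zero) X
  set D : Block m → (Config N →L[ℝ] ℂ) := fun j => fderiv ℝ (blockState N m j).ψ X with hD
  set e : Fin N → Fin 3 → Config N := fun i k => Pi.single i (EuclideanSpace.single k (1 : ℝ))
    with he
  have hpair : ∀ (i : Fin N) (k : Fin 3) (j l : Block m), j ≠ l →
      D j (e i k) = 0 ∨ D l (e i k) = 0 := by
    intro i k j l hjl
    rcases fderiv_blockState_pairwise_zero hN X hjl with h | h
    · left; simp [hD, h]
    · right; simp [hD, h]
  unfold kineticDensity
  rw [fderiv_fun_sum hd]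
  calc ∑ i, ∑ k, ((‖(∑ j, D j) (e i k)‖₊ : ℝ≥0∞)) ^ 2
      = ∑ i, ∑ k, ∑ j, ((‖D j (e i k)‖₊ : ℝ≥0∞)) ^ 2 := by
        refine Finset.sum_congr rfl fun i _ => Finset.sum_congr rfl fun k _ => ?_
        rw [show (∑ j, D j) (e i k) = ∑ j, D j (e i k) by
          rw [FunLike.coe_sum, Finset.sum_apply]]
        exact ennnorm_sum_sq_of_pairwise _ (hpair i k)
    _ = ∑ i, ∑ j, ∑ k, ((‖D j (e i k)‖₊ : ℝ≥0∞)) ^ 2 :=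
        Finset.sum_congr rfl fun i _ => Finset.sum_comm
    _ = ∑ j, ∑ i, ∑ k, ((‖D j (e i k)‖₊ : ℝ≥0∞)) ^ 2 := Finset.sum_comm

/-- `|∑_j β_j^{⊗N}|² = ∑_j |β_j^{⊗N}|²` pointwise (`N ≥ 1`). [folklore] -/
theorem ennnorm_sum_blockState_sq (hN : 0 < N) (X : Config N) :
    ((‖∑ j, (blockState N m j).ψ X‖₊ : ℝ≥0∞)) ^ 2 = ∑ j, ((‖(blockState N m j).ψ X‖₊ : ℝ≥0∞)) ^ 2 :=
  ennnorm_sum_sq_of_pairwise _ fun _ _ hjl => blockState_pairwise_zero hN X hjl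


/-! ### The cat state: equal superposition of the `m³` block condensates -/

variable (N m)

/-- The normalisation `(m³)^{-1/2}`. [folklore] -/
def catCoeff : ℝ := (Real.sqrt ((m : ℝ) ^ 3))⁻¹

/-- The normalisation is non-negative. [folklore] -/
theorem catCoeff_nonneg : 0 ≤ catCoeff m := inv_nonneg.2 (Real.sqrt_nonneg _)

/-- There are `m³` blocks. [folklore] -/
theorem card_block : Fintype.card (Block m) = m ^ 3 := by
  simp

/-- `c² · m³ = 1` (`m ≥ 1`). [folklore] -/
theorem ofReal_catCoeff_sq_mul (hm : 0 < m) :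
    ENNReal.ofReal (catCoeff m ^ 2) * (Fintype.card (Block m) : ℝ≥0∞) = 1 := by
  have h3 : (0 : ℝ) < (m : ℝ) ^ 3 := by positivity
  rw [card_block, catCoeff, inv_pow, Real.sq_sqrt h3.le, Nat.cast_pow, ← ENNReal.ofReal_natCast,
    ← ENNReal.ofReal_pow (Nat.cast_nonneg _), ← ENNReal.ofReal_mul (by positivity),
    inv_mul_cancel₀ h3.ne', ENNReal.ofReal_one]

/-- **The cat wave function** `Ψ_cat = (m³)^{-1/2} ∑_j β_j^{⊗N}`: all `N` particles together in
block `j`, superposed over the `m³` blocks. [folklore] -/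
def catFun (X : Config N) : ℂ := (catCoeff m : ℂ) * ∑ j, (blockState N m j).ψ X

/-- The sum of the block states is `C¹`. [folklore] -/
theorem contDiff_sum_blockState : ContDiff ℝ 1 fun X : Config N => ∑ j, (blockState N m j).ψ X :=
  ContDiff.sum fun j _ => (blockState N m j).contDiff

variable {N m}

/-- The free energy of the cat function is that of one block condensate:
`𝓔₀[Ψ_cat] = N · 𝓔₀[β]` (`N, m ≥ 1`). [folklore] -/
theorem rawEnergy_zero_catFun (hm : 0 < m) (hN : 0 < N) :
    rawEnergy 0 (catFun N m) = N * energy 0 unitBump := by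
  unfold rawEnergy
  simp only [interaction_zeroPotential, zero_mul, add_zero]
  have hpt : ∀ X, kineticDensity (catFun N m) X =
      ENNReal.ofReal (catCoeff m ^ 2) * ∑ j, kineticDensity (blockState N m j).ψ X := by
    intro X
    change kineticDensity (fun Y => (catCoeff m : ℂ) * (fun Z => ∑ j, (blockState N m j).ψ Z) Y) X = _
    rw [kineticDensity_const_mul (contDiff_sum_blockState N m) _ (catCoeff_nonneg m),
      kineticDensity_sum_blockState hN]
  simp_rw [hpt]
  rw [lintegral_const_mul' _ _ ENNReal.ofReal_ne_top,
    lintegral_finsetSum _ fun j _ => measurable_kineticDensity_any _]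
  have hj : ∀ j : Block m, ∫⁻ X, kineticDensity (blockState N m j).ψ X = N * energy 0 unitBump := by
    intro j
    rw [← rawEnergy_zero_blockState j]
    simp [rawEnergy]
  simp_rw [hj]
  rw [Finset.sum_const, Finset.card_univ, nsmul_eq_mul, ← mul_assoc, ofReal_catCoeff_sq_mul m hm,
    one_mul]


/-- The cat function vanishes as soon as one particle is outside the box of side `2m`. [folklore] -/
theorem catFun_eq_zero {X : Config N} (hX : X ∉ boxN N (2 * m)) : catFun N m X = 0 := by
  have : ∃ i, X i ∉ box (2 * m) := by simpa [boxN] using hX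
  obtain ⟨i, hi⟩ := this
  have h0 : ∀ j, (blockState N m j).ψ X = 0 := fun j =>
    (blockState N m j).eq_zero X ⟨i, fun h => hi (blockSet_subset_box m h)⟩
  simp [catFun, h0]

/-- The cat function is normalised (`N, m ≥ 1`). [folklore] -/
theorem lintegral_catFun_sq (hm : 0 < m) (hN : 0 < N) :
    ∫⁻ X, (‖catFun N m X‖₊ : ℝ≥0∞) ^ 2 = 1 := by
  simp only [catFun, ennorm_real_mul_sq _ (catCoeff_nonneg m), ennnorm_sum_blockState_sq hN]
  rw [lintegral_const_mul' _ _ ENNReal.ofReal_ne_top,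
    lintegral_finsetSum _ fun j _ => measurable_normSq (blockState N m j).contDiff.continuous]
  simp_rw [lintegral_blockState_sq]
  rw [Finset.sum_const, Finset.card_univ, nsmul_eq_mul, mul_one, ofReal_catCoeff_sq_mul m hm]

/-- **The cat state** in the box of side `2m` (`N, m ≥ 1`): a Dirichlet trial state.
[folklore] -/
def catState (hm : 0 < m) (hN : 0 < N) : TrialState N (2 * m) where
  ψ := catFun N m
  contDiff := contDiff_const.mul (contDiff_sum_blockState N m)
  eq_zero X hX := catFun_eq_zero hX
  symm σ X := by simp only [catFun, (blockState N m _).symm]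
  norm_eq := lintegral_catFun_sq hm hN

/-- The wave function of the cat state. [folklore] -/
@[simp] theorem catState_ψ (hm : 0 < m) (hN : 0 < N) : (catState hm hN).ψ = catFun N m := rfl

/-- **The cat state has the free energy of a single block condensate**, `N · 𝓔₀[β]` — it sits
`m²`-many kinetic gaps per particle above the ground state once rescaled to a box of side `L`
(`energy_catState_dilate`). [folklore] -/
theorem energy_catState (hm : 0 < m) (hN : 0 < N) :
    energy 0 (catState hm hN) = N * energy 0 unitBump := by
  rw [energy_eq_rawEnergy, catState_ψ, rawEnergy_zero_catFun hm hN]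


/-! ### The one-particle density matrix of the cat state has no eigenvalue above `N/m³` -/

section Occupation

variable {n : ℕ}

/-- Translating all particles commutes with adjoining the first particle. [folklore] -/
theorem vecCons_sub_const (x a : Space) (Y : Config n) :
    ((Matrix.vecCons x Y : Config (n + 1)) - fun _ => a) =
      Matrix.vecCons (x - a) (Y - fun _ => a) := by
  funext i
  refine Fin.cases ?_ (fun i => ?_) i <;> simp

/-- Slices of the cat function: `Ψ_cat(x, Y) = c ∑_j β_j(x) β_j^{⊗n}(Y)`. [folklore] -/
theorem catFun_vecCons (x : Space) (Y : Config n) :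
    catFun (n + 1) m (Matrix.vecCons x Y) =
      (catCoeff m : ℂ) * ∑ j, bumpMode (x - corner m j) * (blockState n m j).ψ Y := by
  simp only [catFun, blockState_ψ, vecCons_sub_const, powFun_vecCons]

/-- `x ↦ ‖g x‖²` is integrable when `∫ ‖g‖² < ∞`. [folklore] -/
theorem integrable_norm_sq_of_lintegral {g : Space → ℂ} (hg : AEStronglyMeasurable g volume)
    (h : ∫⁻ x, (‖g x‖₊ : ℝ≥0∞) ^ 2 ≠ ⊤) : Integrable fun x => ‖g x‖ ^ 2 := by
  refine ⟨hg.norm.pow 2, ?_⟩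
  rw [HasFiniteIntegral]
  refine lt_of_le_of_lt (le_of_eq (lintegral_congr fun x => ?_)) h.lt_top
  rw [enorm_pow, enorm_norm]
  rfl

/-- `conj φ · w` is integrable for square-integrable `φ`, `w`. [folklore] -/
theorem integrable_conj_mul_of_sq {φ w : Space → ℂ} (hφ : AEStronglyMeasurable φ volume)
    (hφ2 : ∫⁻ x, (‖φ x‖₊ : ℝ≥0∞) ^ 2 ≠ ⊤) (hw : AEStronglyMeasurable w volume)
    (hw2 : ∫⁻ x, (‖w x‖₊ : ℝ≥0∞) ^ 2 ≠ ⊤) : Integrable fun x => conj (φ x) * w x := by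
  refine Integrable.mono' ((integrable_norm_sq_of_lintegral hφ hφ2).add
    (integrable_norm_sq_of_lintegral hw hw2))
    ((Complex.continuous_conj.comp_aestronglyMeasurable hφ).mul hw) ?_
  filter_upwards with x
  rw [Pi.add_apply, norm_mul, RCLike.norm_conj]
  nlinarith [sq_nonneg (‖φ x‖ - ‖w x‖), norm_nonneg (φ x), norm_nonneg (w x)]

/-- Translated bump modes are normalised. [folklore] -/
theorem lintegral_bumpMode_sub_sq (a : Space) :
    ∫⁻ x, (‖bumpMode (x - a)‖₊ : ℝ≥0∞) ^ 2 = 1 := by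
  rw [lintegral_sub_right_eq_self (fun x => (‖bumpMode x‖₊ : ℝ≥0∞) ^ 2) a]
  exact lintegral_bumpMode_sq

/-- Translated bump modes are a.e.-strongly measurable. [folklore] -/
theorem aestronglyMeasurable_bumpMode_sub (a : Space) :
    AEStronglyMeasurable (fun x => bumpMode (x - a)) volume :=
  (continuous_bumpMode.comp (continuous_sub_right a)).aestronglyMeasurable

variable {φ : Space → ℂ}

/-- Expansion of the pairing of a mode with a slice of the cat function. [folklore] -/
theorem integral_conj_mul_catFun_vecCons (hφ : AEStronglyMeasurable φ volume)
    (hφ1 : ∫⁻ x, (‖φ x‖₊ : ℝ≥0∞) ^ 2 = 1) (Y : Config n) :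
    ∫ x, conj (φ x) * catFun (n + 1) m (Matrix.vecCons x Y) =
      ∑ j, ((catCoeff m : ℂ) * (blockState n m j).ψ Y) *
        ∫ x, conj (φ x) * bumpMode (x - corner m j) := by
  have hint : ∀ j : Block m, Integrable fun x => conj (φ x) * bumpMode (x - corner m j) :=
    fun j => integrable_conj_mul_of_sq hφ (by rw [hφ1]; exact ENNReal.one_ne_top)
      (aestronglyMeasurable_bumpMode_sub _) (by rw [lintegral_bumpMode_sub_sq]; exact ENNReal.one_ne_top)
  have h : (fun x => conj (φ x) * catFun (n + 1) m (Matrix.vecCons x Y)) = fun x =>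
      ∑ j, ((catCoeff m : ℂ) * (blockState n m j).ψ Y) * (conj (φ x) * bumpMode (x - corner m j)) := by
    funext x
    rw [catFun_vecCons, Finset.mul_sum, Finset.mul_sum]
    exact Finset.sum_congr rfl fun j _ => by ring
  rw [h, integral_finsetSum _ fun j _ => (hint j).const_mul _]
  exact Finset.sum_congr rfl fun j _ => integral_const_mul _ _

/-- Cauchy–Schwarz on the block: `|⟨φ, β_j⟩|² ≤ ∫_{block j} |φ|²`. [folklore] -/
theorem sq_nnnorm_integral_conj_mul_bumpMode_le (hφ : AEStronglyMeasurable φ volume) (j : Block m) :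
    ((‖∫ x, conj (φ x) * bumpMode (x - corner m j)‖₊ : ℝ≥0∞)) ^ 2 ≤
      ∫⁻ x in blockSet m j, (‖φ x‖₊ : ℝ≥0∞) ^ 2 := by
  have hS := measurableSet_blockSet m j
  have hre : (fun x => conj (φ x) * bumpMode (x - corner m j)) =
      fun x => bumpMode (x - corner m j) * conj ((blockSet m j).indicator φ x) := by
    funext x
    by_cases hx : x ∈ blockSet m j
    · rw [Set.indicator_of_mem hx, mul_comm]
    · have : bumpMode (x - corner m j) = 0 := bumpMode_eq_zero hx
      rw [this, zero_mul, mul_zero]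
  rw [hre]
  calc ((‖∫ x, bumpMode (x - corner m j) * conj ((blockSet m j).indicator φ x)‖₊ : ℝ≥0∞)) ^ 2
      ≤ (∫⁻ x, (‖bumpMode (x - corner m j)‖₊ : ℝ≥0∞) ^ 2) *
          ∫⁻ x, (‖(blockSet m j).indicator φ x‖₊ : ℝ≥0∞) ^ 2 :=
        sq_nnnorm_integral_mul_conj_le (aestronglyMeasurable_bumpMode_sub _).aemeasurable
          (hφ.aemeasurable.indicator hS)
    _ = ∫⁻ x in blockSet m j, (‖φ x‖₊ : ℝ≥0∞) ^ 2 := by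
        rw [lintegral_bumpMode_sub_sq, one_mul, ← lintegral_indicator hS]
        refine lintegral_congr fun x => ?_
        by_cases hx : x ∈ blockSet m j
        · rw [Set.indicator_of_mem hx, Set.indicator_of_mem hx]
        · rw [Set.indicator_of_notMem hx, Set.indicator_of_notMem hx]
          simp

/-- The blocks are disjoint, so `∑_j ∫_{block j} |φ|² ≤ ∫ |φ|²`. [folklore] -/
theorem sum_setLIntegral_blockSet_le (hφ : AEStronglyMeasurable φ volume) :
    ∑ j : Block m, ∫⁻ x in blockSet m j, (‖φ x‖₊ : ℝ≥0∞) ^ 2 ≤ ∫⁻ x, (‖φ x‖₊ : ℝ≥0∞) ^ 2 := by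
  have hg : AEMeasurable (fun x => (‖φ x‖₊ : ℝ≥0∞) ^ 2) volume :=
    hφ.aemeasurable.nnnorm.coe_nnreal_ennreal.pow_const 2
  calc ∑ j : Block m, ∫⁻ x in blockSet m j, (‖φ x‖₊ : ℝ≥0∞) ^ 2
      = ∑ j : Block m, ∫⁻ x, (blockSet m j).indicator (fun x => (‖φ x‖₊ : ℝ≥0∞) ^ 2) x :=
        Finset.sum_congr rfl fun j _ => (lintegral_indicator (measurableSet_blockSet m j) _).symm
    _ = ∫⁻ x, ∑ j : Block m, (blockSet m j).indicator (fun x => (‖φ x‖₊ : ℝ≥0∞) ^ 2) x :=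
        (lintegral_finsetSum' _ fun j _ => hg.indicator (measurableSet_blockSet m j)).symm
    _ ≤ ∫⁻ x, (‖φ x‖₊ : ℝ≥0∞) ^ 2 :=
        lintegral_mono fun x => sum_indicator_le_of_pairwise _
          (fun j l hjl x hx => not_mem_blockSet_of_ne m hjl hx) _ x

/-- **Occupations in the cat state are at most `N/m³`**: for every normalised mode `φ`,
`⟨φ, γ_{Ψ_cat} φ⟩ ≤ N · c² = N/m³` (`N = n + 1 ≥ 2`). The one-particle density matrix of the cat
state is `(N/m³) ∑_j |β_j⟩⟨β_j|`. [folklore] -/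
theorem occupation_catFun_le (hn : 0 < n) (hφ : AEStronglyMeasurable φ volume)
    (hφ1 : ∫⁻ x, (‖φ x‖₊ : ℝ≥0∞) ^ 2 = 1) :
    occupation (n + 1) φ (catFun (n + 1) m) ≤ (n + 1 : ℝ≥0∞) * ENNReal.ofReal (catCoeff m ^ 2) := by
  set a : Block m → ℂ := fun j => ∫ x, conj (φ x) * bumpMode (x - corner m j) with ha
  -- pointwise collapse of the slice pairing
  have hpt : ∀ Y : Config n,
      ((‖∫ x, conj (φ x) * catFun (n + 1) m (Matrix.vecCons x Y)‖₊ : ℝ≥0∞)) ^ 2 =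
        ∑ j, (ENNReal.ofReal (catCoeff m ^ 2) * (‖a j‖₊ : ℝ≥0∞) ^ 2) *
          ((‖(blockState n m j).ψ Y‖₊ : ℝ≥0∞)) ^ 2 := by
    intro Y
    rw [integral_conj_mul_catFun_vecCons hφ hφ1 Y, ennnorm_sum_sq_of_pairwise]
    · refine Finset.sum_congr rfl fun j _ => ?_
      rw [ennnorm_mul_sq, ennorm_real_mul_sq _ (catCoeff_nonneg m)]
      ring
    · intro j l hjl
      rcases blockState_pairwise_zero hn Y hjl with h | h
      · left; simp [h]
      · right; simp [h]
  have hmeas : ∀ j : Block m, Measurable fun Y : Config n =>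
      ((‖(blockState n m j).ψ Y‖₊ : ℝ≥0∞)) ^ 2 :=
    fun j => measurable_normSq (blockState n m j).contDiff.continuous
  have hne : ∀ j : Block m, ENNReal.ofReal (catCoeff m ^ 2) * (‖a j‖₊ : ℝ≥0∞) ^ 2 ≠ ⊤ :=
    fun j => ENNReal.mul_ne_top ENNReal.ofReal_ne_top (ENNReal.pow_ne_top ENNReal.coe_ne_top)
  change (n + 1 : ℝ≥0∞) * ∫⁻ Y : Config n,
      ((‖∫ x, conj (φ x) * catFun (n + 1) m (Matrix.vecCons x Y)‖₊ : ℝ≥0∞)) ^ 2 ≤ _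
  gcongr
  simp_rw [hpt]
  rw [lintegral_finsetSum _ fun j _ => (hmeas j).const_mul _]
  simp_rw [lintegral_const_mul' _ _ (hne _), lintegral_blockState_sq, mul_one, ← Finset.mul_sum]
  calc ENNReal.ofReal (catCoeff m ^ 2) * ∑ j, ((‖a j‖₊ : ℝ≥0∞)) ^ 2
      ≤ ENNReal.ofReal (catCoeff m ^ 2) * ∑ j, ∫⁻ x in blockSet m j, (‖φ x‖₊ : ℝ≥0∞) ^ 2 := by
        gcongr with j
        exact sq_nnnorm_integral_conj_mul_bumpMode_le hφ j
    _ ≤ ENNReal.ofReal (catCoeff m ^ 2) * 1 := by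
        gcongr
        exact (sum_setLIntegral_blockSet_le hφ).trans hφ1.le
    _ = _ := mul_one _

/-- **`λ_max(γ_{Ψ_cat}) ≤ N/m³`** (`N ≥ 2`, `m ≥ 1`): the cat state is fragmented over the `m³`
blocks. [folklore] -/
theorem maxOccupation_catFun_le (hn : 0 < n) :
    maxOccupation (n + 1) (catFun (n + 1) m) ≤ (n + 1 : ℝ≥0∞) * ENNReal.ofReal (catCoeff m ^ 2) :=
  iSup₂_le fun _ hφ => occupation_catFun_le hn hφ.1 hφ.2

end Occupation


/-! ### Rescaling to an arbitrary box: fragmented states `m²` gaps above the ground state -/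

section Rescale

variable {L L' : ℝ}

/-- Transport of a trial state along an equality of box sides. [folklore] -/
def TrialState.castLen (h : L = L') (Ψ : TrialState N L) : TrialState N L' := h ▸ Ψ

/-- Transport does not change the wave function. [folklore] -/
@[simp] theorem TrialState.castLen_ψ (h : L = L') (Ψ : TrialState N L) :
    (Ψ.castLen h).ψ = Ψ.ψ := by
  subst h; rfl

/-- Transport does not change the energy. [folklore] -/
theorem TrialState.energy_castLen (v : ℝ → ℝ≥0∞) (h : L = L') (Ψ : TrialState N L) :
    energy v (Ψ.castLen h) = energy v Ψ := by
  subst h; rfl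

/-- The universal constant `C_cat = 4 𝓔₀[β]` (four times the kinetic energy of the unit bump).
[folklore] -/
def catEnergyConst : ℝ := 4 * (energy 0 unitBump).toReal

/-- The free energy of the unit bump as a real number. [folklore] -/
theorem energy_unitBump_eq_ofReal : energy 0 unitBump = ENNReal.ofReal (energy 0 unitBump).toReal :=
  (ENNReal.ofReal_toReal energy_unitBump_lt_top.ne).symm

/-- `C_cat > 0` (the unit bump pays at least the Dirichlet wall `π²/8`). [folklore] -/
theorem catEnergyConst_pos : 0 < catEnergyConst := by
  have hwall := dirichlet_wall_energy_one one_pos (0 : ℝ → ℝ≥0∞) unitBump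
  have hpos : 0 < (energy 0 unitBump).toReal := by
    rw [← ENNReal.ofReal_lt_ofReal_iff_of_nonneg le_rfl, ENNReal.ofReal_zero,
      ← energy_unitBump_eq_ofReal]
    refine lt_of_lt_of_le ?_ hwall
    rw [ENNReal.ofReal_pos]; positivity
  unfold catEnergyConst; positivity

/-- **Fragmented low-energy states in every box** (free gas, Dirichlet): for all `m ≥ 1`,
`N ≥ 2`, `L > 0` there is a Dirichlet trial state of `Λ_L` with energy
`≤ C_cat m² N / L²` (`m²` kinetic gaps per particle, up to the universal `C_cat`) whose
one-particle density matrix has NO eigenvalue above `N/m³` (`λ_max ≤ N/m³`). Witness: the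
dilated cat state `Ψ_cat`, all particles together in one of `m³` sub-cubes, superposed.
[folklore] -/
theorem exists_fragmented_trialState {m N : ℕ} (hm : 0 < m) (hN : 2 ≤ N) (hL : 0 < L) :
    ∃ Ψ : TrialState N L,
      energy 0 Ψ ≤ ENNReal.ofReal (catEnergyConst * m ^ 2 * N / L ^ 2) ∧
        maxOccupation N Ψ.ψ ≤ ENNReal.ofReal (N / m ^ 3) := by
  obtain ⟨n, rfl⟩ : ∃ n, N = n + 1 := ⟨N - 1, by omega⟩
  have hn : 0 < n := by omega
  have hN0 : 0 < n + 1 := Nat.succ_pos n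
  have hm0 : (0 : ℝ) < m := Nat.cast_pos.2 hm
  set s : ℝ := L / (2 * m) with hs
  have hs0 : 0 < s := by positivity
  have hsL : s * (2 * (m : ℕ)) = L := by rw [hs]; field_simp
  refine ⟨((catState hm hN0).dilate hs0).castLen hsL, ?_, ?_⟩
  · rw [TrialState.energy_castLen]
    have h := TrialState.energy_dilate 0 (catState hm hN0) hs0
    rw [scalePotential_zero] at h
    rw [h, energy_catState hm hN0, energy_unitBump_eq_ofReal, ← ENNReal.ofReal_natCast,
      ← ENNReal.ofReal_mul (by positivity), ← ENNReal.ofReal_mul (by positivity)]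
    refine ENNReal.ofReal_le_ofReal (le_of_eq ?_)
    rw [catEnergyConst, hs]
    field_simp
    ring
  · rw [TrialState.castLen_ψ, TrialState.maxOccupation_dilate, catState_ψ]
    refine (maxOccupation_catFun_le hn).trans (le_of_eq ?_)
    have h3 : (0 : ℝ) < (m : ℝ) ^ 3 := by positivity
    rw [show (n + 1 : ℝ≥0∞) = ((n + 1 : ℕ) : ℝ≥0∞) by push_cast; rfl, ← ENNReal.ofReal_natCast,
      catCoeff, inv_pow, Real.sq_sqrt h3.le, ← ENNReal.ofReal_mul (by positivity)]
    congr 1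

/-- `ofReal (c N) ≤ ofReal (N/m³)` with `N > 0` gives `c ≤ 1/m³`. [folklore] -/
theorem le_inv_pow_of_ofReal_mul_le {c : ℝ} {N m : ℕ} (hN : 0 < N) (hm : 0 < m)
    (h : ENNReal.ofReal (c * N) ≤ ENNReal.ofReal (N / m ^ 3)) : c ≤ 1 / m ^ 3 := by
  have hN' : (0 : ℝ) < N := Nat.cast_pos.2 hN
  have hm' : (0 : ℝ) < (m : ℝ) ^ 3 := by positivity
  rw [ENNReal.ofReal_le_ofReal_iff (by positivity)] at h
  rw [le_div_iff₀ hm']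
  rw [le_div_iff₀ hm'] at h
  nlinarith

/-- **Mode-free energy-window criteria in a Dirichlet box are gap-limited** (free gas): if every
Dirichlet trial state of `Λ_L` with energy `≤ E₀^D + w` had `λ_max(γ) ≥ cN`, and the window `w`
contains `C_cat m²` kinetic gaps per particle, then `c ≤ 1/m³` (`N ≥ 2`). [folklore] -/
theorem dirichlet_window_fraction_le {m N : ℕ} (hm : 0 < m) (hN : 2 ≤ N) (hL : 0 < L) {c : ℝ}
    {w : ℝ≥0∞} (hw : ENNReal.ofReal (catEnergyConst * m ^ 2 * N / L ^ 2) ≤ w)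
    (hcrit : ∀ Ψ : TrialState N L, energy 0 Ψ ≤ groundStateEnergy 0 N L + w →
      ENNReal.ofReal (c * N) ≤ maxOccupation N Ψ.ψ) :
    c ≤ 1 / m ^ 3 := by
  obtain ⟨Ψ, hE, hocc⟩ := exists_fragmented_trialState hm hN hL
  have hwin : energy 0 Ψ ≤ groundStateEnergy 0 N L + w :=
    (hE.trans hw).trans le_add_self
  exact le_inv_pow_of_ofReal_mul_le (by omega) hm ((hcrit Ψ hwin).trans hocc)

end Rescale


/-! ### The periodic side: `n₀ ≤ λ_max ≤ N/m³` for the periodised cat states -/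

section Periodic

variable {L : ℝ}

/-- The cell truncation of the periodisation of a Dirichlet state of `Λ_L` is the state itself.
[folklore] -/
theorem indicator_cellN_periodize (Ψ : TrialState N L) (hL : 0 < L) :
    (cellN N L).indicator (periodize L Ψ.ψ) = Ψ.ψ := by
  funext X
  by_cases hX : X ∈ cellN N L
  · rw [Set.indicator_of_mem hX, periodize_of_mem_cellN hL Ψ.ψ hX]
  · rw [Set.indicator_of_notMem hX, Ψ.eq_zero X fun h => hX (boxN_subset_cellN le_rfl h)]

/-- The constant mode is a.e.-strongly measurable. [folklore] -/
theorem aestronglyMeasurable_constantMode (L : ℝ) :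
    AEStronglyMeasurable (constantMode L) volume :=
  aestronglyMeasurable_const.indicator (measurableSet_cell L)

/-- The constant mode is normalised (`L > 0`). [folklore] -/
theorem lintegral_constantMode_sq (hL : 0 < L) :
    ∫⁻ x, (‖constantMode L x‖₊ : ℝ≥0∞) ^ 2 = 1 := by
  have hL3 : 0 < L ^ 3 := by positivity
  have hc : ((‖((Real.sqrt (L ^ 3))⁻¹ : ℂ)‖₊ : ℝ≥0∞) ^ 2) = ENNReal.ofReal ((L ^ 3)⁻¹) := by
    rw [← ENNReal.coe_pow, ENNReal.ofReal, ENNReal.coe_inj]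
    ext
    rw [NNReal.coe_pow, coe_nnnorm, norm_inv, Complex.norm_real,
      Real.norm_of_nonneg (Real.sqrt_nonneg _), inv_pow, Real.sq_sqrt hL3.le,
      Real.coe_toNNReal _ (by positivity)]
  have hpt : ∀ x, (‖constantMode L x‖₊ : ℝ≥0∞) ^ 2 =
      (cell L).indicator (fun _ => ENNReal.ofReal ((L ^ 3)⁻¹)) x := by
    intro x
    unfold constantMode
    by_cases hx : x ∈ cell L
    · rw [Set.indicator_of_mem hx, Set.indicator_of_mem hx, hc]
    · rw [Set.indicator_of_notMem hx, Set.indicator_of_notMem hx]; simp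
  simp_rw [hpt]
  rw [lintegral_indicator (measurableSet_cell L), setLIntegral_const, volume_cell,
    ← ENNReal.ofReal_pow hL.le, ← ENNReal.ofReal_mul (by positivity), inv_mul_cancel₀ hL3.ne',
    ENNReal.ofReal_one]

/-- **`n₀ ≤ λ_max`** for periodised Dirichlet states: the constant-mode occupation of the
periodisation is one of the occupations entering `λ_max(γ_Ψ)`. [folklore] -/
theorem condensateOccupation_toPeriodic_le_maxOccupation (Ψ : TrialState N L) (hL : 0 < L) :
    condensateOccupation N L (Ψ.toPeriodic hL le_rfl).ψ ≤ maxOccupation N Ψ.ψ := by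
  show occupation N (constantMode L) ((cellN N L).indicator (periodize L Ψ.ψ)) ≤ _
  rw [indicator_cellN_periodize Ψ hL]
  exact occupation_le_maxOccupation Ψ.ψ (aestronglyMeasurable_constantMode L)
    (lintegral_constantMode_sq hL)

/-- **Fragmented low-energy states on every torus** (free gas): for `m ≥ 1`, `N ≥ 2`, `L > 0`
there is a periodic trial state with `⟨Φ, -ΔΦ⟩ ≤ C_cat m² N/L²` whose cell-truncated one-particle
density matrix has `λ_max ≤ N/m³`, hence also `⟨Φ, n₀Φ⟩ ≤ N/m³`. (Cubic improvement, and
mode-free extension, of the Galilei-boost witnesses of `KineticGapLengthScalesNarrow`: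
window `∼M²` gaps gives `n₀ ≤ N/(M+1)` there, `n₀ ≤ λ_max ≤ N/M³` here.) [folklore] -/
theorem exists_fragmented_periodicTrialState {m N : ℕ} (hm : 0 < m) (hN : 2 ≤ N) (hL : 0 < L) :
    ∃ Φ : PeriodicTrialState N L,
      periodicEnergy 0 Φ ≤ ENNReal.ofReal (catEnergyConst * m ^ 2 * N / L ^ 2) ∧
        maxOccupation N ((cellN N L).indicator Φ.ψ) ≤ ENNReal.ofReal (N / m ^ 3) ∧
          condensateOccupation N L Φ.ψ ≤ ENNReal.ofReal (N / m ^ 3) := by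
  obtain ⟨Ψ, hE, hocc⟩ := exists_fragmented_trialState hm hN hL
  refine ⟨Ψ.toPeriodic hL le_rfl, ?_, ?_, ?_⟩
  · exact (Ψ.periodicEnergy_toPeriodic_le (R₀ := 0) (fun _ _ => rfl) hL le_rfl (by linarith)).trans
      hE
  · show maxOccupation N ((cellN N L).indicator (periodize L Ψ.ψ)) ≤ _
    rw [indicator_cellN_periodize Ψ hL]
    exact hocc
  · exact (condensateOccupation_toPeriodic_le_maxOccupation Ψ hL).trans hocc

/-- **Periodic energy-window criteria are gap-limited, cubically** (free gas, any torus, `N ≥ 2`):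
a criterion "`⟨Φ,HΦ⟩ ≤ E₀^per + w ⇒ ⟨Φ, n₀Φ⟩ ≥ cN`" whose window contains `C_cat m²` gaps per
particle certifies at most `c ≤ 1/m³`. [folklore] -/
theorem periodic_window_fraction_le {m N : ℕ} (hm : 0 < m) (hN : 2 ≤ N) (hL : 0 < L) {c : ℝ}
    {w : ℝ≥0∞} (hw : ENNReal.ofReal (catEnergyConst * m ^ 2 * N / L ^ 2) ≤ w)
    (hcrit : ∀ Φ : PeriodicTrialState N L, periodicEnergy 0 Φ ≤ periodicGroundStateEnergy 0 N L + w →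
      ENNReal.ofReal (c * N) ≤ condensateOccupation N L Φ.ψ) :
    c ≤ 1 / m ^ 3 := by
  obtain ⟨Φ, hE, -, hocc⟩ := exists_fragmented_periodicTrialState hm hN hL
  have hwin : periodicEnergy 0 Φ ≤ periodicGroundStateEnergy 0 N L + w :=
    (hE.trans hw).trans le_add_self
  exact le_inv_pow_of_ofReal_mul_le (by omega) hm ((hcrit Φ hwin).trans hocc)

/-- The same for the MODE-FREE periodic criterion (`λ_max` of the cell-truncated state).
[folklore] -/
theorem periodic_modeFree_window_fraction_le {m N : ℕ} (hm : 0 < m) (hN : 2 ≤ N) (hL : 0 < L)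
    {c : ℝ} {w : ℝ≥0∞} (hw : ENNReal.ofReal (catEnergyConst * m ^ 2 * N / L ^ 2) ≤ w)
    (hcrit : ∀ Φ : PeriodicTrialState N L, periodicEnergy 0 Φ ≤ periodicGroundStateEnergy 0 N L + w →
      ENNReal.ofReal (c * N) ≤ maxOccupation N ((cellN N L).indicator Φ.ψ)) :
    c ≤ 1 / m ^ 3 := by
  obtain ⟨Φ, hE, hocc, -⟩ := exists_fragmented_periodicTrialState hm hN hL
  have hwin : periodicEnergy 0 Φ ≤ periodicGroundStateEnergy 0 N L + w :=
    (hE.trans hw).trans le_add_self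
  exact le_inv_pow_of_ofReal_mul_le (by omega) hm ((hcrit Φ hwin).trans hocc)

end Periodic

end Literature.MathematicalPhysics.QuantumManyBody.BoseGas

end
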